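import Literature.Probability.Percolation.ZdFiveArmUniqueness
import HarnessLib

/-!
# The landed five-arm event of `ZdFiveArmUniqueness.lean` from five arms (introduction rule)

Topic `Literature/Probability/Percolation`; proofs only (no definition, no named fact). Companion of
`ZdFiveArmUniqueness.lean` (KSZ 1998, proof of Lemma 5, (3.10)–(3.11); Nolin 2008, proof of
Thm. 24: the landed five-arm event `zdFiveArmKSZ M N v` occurs for at most one vertex `v`). There
the two dual arms of KSZ's `F(w, n)` ("two vacant paths from neighbors of `w`, to the upper edge and
to the lower edge of `S(n)`") are recorded as ONE face walk from the top face row to the bottom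
face row whose steps cross closed edges except between faces around `v`. This file provides the
introduction rule in the printed five-arm form — three open arms and TWO closed dual arms starting
from faces around `v` — which is the shape in which the comparison step of the upper bound
(KSZ (3.12); Nolin Thm. 11, Prop. 12: extension of separated arms) produces the event:

* `ZdFiveArmKSZ.exists_cornerWalk` — any two faces around `v` are joined by a face walk through
  faces around `v` (at most two steps around the vertex);
* `ZdFiveArmKSZ.cornerFaces_bounds` — the faces around an interior vertex of `R` lie in the dual
  rectangle;
* `mem_zdFiveArmKSZ_of_arms` — **three open arms (left, right, right; pairwise vertex-disjoint
  off `v`) and two closed dual arms from faces around `v` to the top and bottom face rows give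
  `zdFiveArmKSZ M N v`**, for `v` with `1 ≤ v₀ ≤ M - 1`.

References: H. Kesten, V. Sidoravicius, Y. Zhang, EJP 3 (1998), proof of Lemma 5, (3.10);
P. Nolin, EJP 13 (2008), §5.2, proof of Thm. 24 (arXiv 0711.4948: p. 16, the event `A_v`).
-/

noncomputable section

open Set SimpleGraph

namespace Literature.Probability.Percolation

open LatticeModels

/-- **Any two faces around `v` are joined through faces around `v`**: a face walk of at most two
steps (first horizontal, then vertical) inside `cornerFaces v`. [folklore] -/
theorem ZdFiveArmKSZ.exists_cornerWalk {v f g : Site 2} (hf : f ∈ cornerFaces v)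
    (hg : g ∈ cornerFaces v) :
    ∃ J : (zdGraph 2).Walk f g, ∀ z ∈ J.support, z ∈ cornerFaces v := by
  obtain ⟨hf0, hf1⟩ := hf
  obtain ⟨hg0, hg1⟩ := hg
  -- the intermediate face `(g₀, f₁)`
  obtain ⟨m, hm0, hm1⟩ : ∃ m : Site 2, m 0 = g 0 ∧ m 1 = f 1 := ⟨![g 0, f 1], by simp, by simp⟩
  have hmc : m ∈ cornerFaces v := by
    rw [mem_cornerFaces_iff, hm0, hm1]; exact ⟨hg0, hf1⟩
  -- first leg: `f` to `m` (horizontal or trivial)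
  have leg₁ : ∃ J : (zdGraph 2).Walk f m, ∀ z ∈ J.support, z ∈ cornerFaces v := by
    by_cases h0 : f 0 = g 0
    · obtain rfl : f = m := by
        rw [LatticeModels.Site.eq_iff_two, hm0, hm1]; exact ⟨h0, rfl⟩
      exact ⟨Walk.nil, fun z hz => by
        rw [Walk.support_nil, List.mem_singleton] at hz; rw [hz]; exact ⟨hf0, hf1⟩⟩
    · have hadj : (zdGraph 2).Adj f m := by
        rcases hf0 with hf0 | hf0 <;> rcases hg0 with hg0 | hg0
        · exact absurd (hf0.trans hg0.symm) h0
        · exact adj_of_stepKind (.left (by omega) (by omega))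
        · exact adj_of_stepKind (.right (by omega) (by omega))
        · exact absurd (by omega) h0
      refine ⟨Walk.cons hadj Walk.nil, fun z hz => ?_⟩
      rw [Walk.support_cons, Walk.support_nil, List.mem_cons, List.mem_singleton] at hz
      rcases hz with rfl | rfl
      exacts [⟨hf0, hf1⟩, hmc]
  -- second leg: `m` to `g` (vertical or trivial)
  have leg₂ : ∃ J : (zdGraph 2).Walk m g, ∀ z ∈ J.support, z ∈ cornerFaces v := by
    by_cases h1 : f 1 = g 1
    · obtain rfl : m = g := by
        rw [LatticeModels.Site.eq_iff_two, hm0, hm1]; exact ⟨rfl, h1⟩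
      exact ⟨Walk.nil, fun z hz => by
        rw [Walk.support_nil, List.mem_singleton] at hz; rw [hz]; exact hmc⟩
    · have hadj : (zdGraph 2).Adj m g := by
        rcases hf1 with hf1 | hf1 <;> rcases hg1 with hg1 | hg1
        · exact absurd (hf1.trans hg1.symm) h1
        · exact adj_of_stepKind (.down (by omega) (by omega))
        · exact adj_of_stepKind (.up (by omega) (by omega))
        · exact absurd (by omega) h1
      refine ⟨Walk.cons hadj Walk.nil, fun z hz => ?_⟩
      rw [Walk.support_cons, Walk.support_nil, List.mem_cons, List.mem_singleton] at hz
      rcases hz with rfl | rfl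
      exacts [hmc, ⟨hg0, hg1⟩]
  obtain ⟨J₁, hJ₁⟩ := leg₁
  obtain ⟨J₂, hJ₂⟩ := leg₂
  refine ⟨J₁.append J₂, fun z hz => ?_⟩
  rw [Walk.mem_support_append_iff] at hz
  rcases hz with hz | hz
  exacts [hJ₁ z hz, hJ₂ z hz]

/-- The faces around a vertex `v` with `1 ≤ v₀ ≤ M - 1` and `0 ≤ v₁ ≤ N` lie in the dual rectangle
`[0, M-1] × [-1, N]`. [folklore] -/
theorem ZdFiveArmKSZ.cornerFaces_bounds {M N : ℕ} {v z : Site 2} (hz : z ∈ cornerFaces v)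
    (hv0 : 1 ≤ v 0) (hv0' : v 0 + 1 ≤ M) (hv1 : 0 ≤ v 1) (hv1' : v 1 ≤ N) :
    (0 : ℤ) ≤ z 0 ∧ z 0 + 1 ≤ M ∧ (-1 : ℤ) ≤ z 1 ∧ z 1 ≤ N := by
  obtain ⟨hz0, hz1⟩ := hz
  omega

/-- **The landed five-arm event from five arms** (KSZ's `F(w, n)`, bond form, as printed: "three
of these [paths] are occupied and have their endpoint on the left [and right] edge of `S(n)`; the
two remaining paths are vacant and have their endpoint on the upper edge and lower edge"): at a
vertex `v` with `1 ≤ v₀ ≤ M - 1`, three open lattice walks inside `R = [0, M] × [0, N]` from `v` to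
the left side and (twice) to the right side, pairwise vertex-disjoint off `v`, together with two
face walks of the dual rectangle crossing CLOSED edges, from faces around `v` to the top face row
and to the bottom face row, give `zdFiveArmKSZ M N v` — the two dual arms are joined through the
faces around `v` (`ZdFiveArmKSZ.exists_cornerWalk`). [cite: KestenSidoraviciusZhang1998, proof of Lemma 5, (3.10)] [cite: Nolin2008, §5.2, proof of Thm. 24 (arXiv 0711.4948: p. 16, the event A_v)] -/
theorem mem_zdFiveArmKSZ_of_arms {M N : ℕ} {ω : BondConfig (Site 2)} {v l r r' f g t s : Site 2}
    (hv0 : 1 ≤ v 0) (hv0' : v 0 + 1 ≤ M)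
    (P₁ : (zdGraph 2).Walk v l) (P₃ : (zdGraph 2).Walk v r) (P₄ : (zdGraph 2).Walk v r')
    (hl : l 0 = 0) (hr : r 0 = M) (hr' : r' 0 = M)
    (hs₁ : ∀ z ∈ P₁.support, (0 : ℤ) ≤ z 0 ∧ z 0 ≤ M ∧ (0 : ℤ) ≤ z 1 ∧ z 1 ≤ N)
    (hs₃ : ∀ z ∈ P₃.support, (0 : ℤ) ≤ z 0 ∧ z 0 ≤ M ∧ (0 : ℤ) ≤ z 1 ∧ z 1 ≤ N)
    (hs₄ : ∀ z ∈ P₄.support, (0 : ℤ) ≤ z 0 ∧ z 0 ≤ M ∧ (0 : ℤ) ≤ z 1 ∧ z 1 ≤ N)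
    (he₁ : ∀ e ∈ P₁.edges, e ∈ ω) (he₃ : ∀ e ∈ P₃.edges, e ∈ ω) (he₄ : ∀ e ∈ P₄.edges, e ∈ ω)
    (h₁₃ : ∀ z ∈ P₁.support, z ∈ P₃.support → z = v)
    (h₁₄ : ∀ z ∈ P₁.support, z ∈ P₄.support → z = v)
    (h₃₄ : ∀ z ∈ P₃.support, z ∈ P₄.support → z = v)
    (hf : f ∈ cornerFaces v) (hg : g ∈ cornerFaces v)
    (Q₂ : (zdGraph 2).Walk f t) (ht : t 1 = N)
    (hQ₂s : ∀ z ∈ Q₂.support, (0 : ℤ) ≤ z 0 ∧ z 0 + 1 ≤ M ∧ (-1 : ℤ) ≤ z 1 ∧ z 1 ≤ N)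
    (hQ₂c : ∀ d ∈ Q₂.darts, sepEdge d.fst d.snd ∉ ω)
    (Q₅ : (zdGraph 2).Walk g s) (hs : s 1 = -1)
    (hQ₅s : ∀ z ∈ Q₅.support, (0 : ℤ) ≤ z 0 ∧ z 0 + 1 ≤ M ∧ (-1 : ℤ) ≤ z 1 ∧ z 1 ≤ N)
    (hQ₅c : ∀ d ∈ Q₅.darts, sepEdge d.fst d.snd ∉ ω) :
    ω ∈ zdFiveArmKSZ M N v := by
  -- `v` lies in `R` (it is the start of `P₁`)
  have hv := hs₁ v P₁.start_mem_support
  obtain ⟨J, hJ⟩ := ZdFiveArmKSZ.exists_cornerWalk hf hg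
  refine ⟨l, r, r', P₁, P₃, P₄, hl, hr, hr', hs₁, hs₃, hs₄, he₁, he₃, he₄, h₁₃, h₁₄, h₃₄, t, s,
    Q₂.reverse.append (J.append Q₅), ht, hs, fun z hz => ?_, fun d hd => ?_⟩
  · rw [Walk.mem_support_append_iff, Walk.support_reverse, List.mem_reverse,
      Walk.mem_support_append_iff] at hz
    rcases hz with hz | hz | hz
    · exact hQ₂s z hz
    · exact ZdFiveArmKSZ.cornerFaces_bounds (hJ z hz) hv0 hv0' hv.2.2.1 hv.2.2.2
    · exact hQ₅s z hz
  · rw [Walk.darts_append, List.mem_append, Walk.mem_darts_reverse, Walk.darts_append,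
      List.mem_append] at hd
    rcases hd with hd | hd | hd
    · left
      rw [show sepEdge d.fst d.snd = sepEdge d.symm.fst d.symm.snd from sepEdge_comm _ _]
      exact hQ₂c _ hd
    · exact Or.inr ⟨hJ _ (J.dart_fst_mem_support_of_mem_darts hd),
        hJ _ (J.dart_snd_mem_support_of_mem_darts hd)⟩
    · exact Or.inl (hQ₅c d hd)

end Literature.Probability.Percolation

end
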